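import Literature.NumberTheory.EllipticCurves.ZpExtensionEisensteinDVRSettingResidualCompatProofs
import Literature.NumberTheory.EllipticCurves.ZpExtensionEisensteinTwistFreeProofs
import Literature.NumberTheory.EllipticCurves.ZpExtensionEisensteinTwistHowardH1Proofs
import HarnessLib

/-!
# The Eisenstein `DVRSetting` of the curve: hypotheses H.0, H.1 and H.5(a) of `SatisfiesH` BY NAME (proofs file)

Topic `NumberTheory/EllipticCurves` (D1 road of cell `pub/bsd-print-x9`; companion of `ZpExtensionEisensteinDVRSetting`).
THEOREMS ONLY; no definition, no named fact, no instance, no notation, no `sorry`.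

For the curve's Eisenstein setting `S := W.eisensteinDVRSetting κ hm S hpS hbad L hL hLS jbar cd D fs` (Howard's §1.6 data
at `𝔮 = (T^m + p)`), three of the hypotheses of `DVRSetting.SatisfiesH` in the exact heads of the part-B file, from the tree's
level-wise theorems:
* **`eisensteinDVRSetting_h0`** — H.0 at every level: `T^{(k)} = E_K[p^{k+1}] ⊗ A_{m,k+1}` is free of rank two over
  `A_{m,k+1}` (`howardH0_twisted_geomTorsion`, p640112; `p ≠ 0` in the number field `K`);
* **`eisensteinDVRSetting_h1_of_schur`** — H.1 at every level for the PINNED residual presentation `π̄_k` of the setting,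
  from `(irr_K)` and the Schur form on `E_K[p]` (`howardH1_eisensteinTwist_geomTorsion_of_schur`, p642153, whose
  presentation is identified with `π̄_k`: two `A_{m,k+1}`-linear maps out of `E_K[p^{k+1}] ⊗ A_{m,k+1}` with the same values
  `p^k P` on `1 ⊗ P` agree — `eisensteinDVRSetting_πbar_eq_of_tmul`); the `Thm413Hypotheses` form
  `eisensteinDVRSetting_h1` (Schur clause = `exists_forall_eq_zsmul_of_hasIrreducibleModPGaloisRep`);
* **`eisensteinDVRSetting_h5a`** — H.5(a) at every level when `cd.τ` is a complex conjugation (`c₀ ∈ Γ_ℚ` transported to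
  `K̄`) and `p ≠ 2` (`h5a_residualTauGeomTorsion_of_isComplexConjugation`, p642668).
Every statement carries the CONSUMER PREAMBLE of `ZpExtensionEisensteinDVRSetting`.  BSD is not proved by any of this.

References: [Howard2004HeegnerKolyvagin] §1.3 H.0, H.1, H.5(a) (arXiv:1202.6340 p. 7 L57–59, L93–95), proof of Prop. 2.1.3;
[SilvermanAEC2009] Cor. III.6.4(b); [Serre1972] §1.11; [GrossLMS1991] Prop. 9.5 (1).
-/

set_option autoImplicit false

noncomputable section

open Function NumberField IsDedekindDomain Field
open scoped NumberField ContRepresentation TensorProduct Classical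

namespace WeierstrassCurve

open Literature.NumberTheory.EllipticCurves Literature.NumberTheory.GaloisRepresentations
open Literature.NumberTheory.GaloisRepresentations.DiscreteGaloisModule
open Literature.NumberTheory.GaloisCohomology.Howard2004
open Literature.NumberTheory.EllipticCurves.ZpExtension (EisensteinLevel)

variable {K : Type} [Field K] [NumberField K] (W : WeierstrassCurve ℚ) [W.IsElliptic] {p : ℕ} [hp : Fact p.Prime]
  (κ : ZpExtension K p) {m : ℕ} (hm : 1 ≤ m)
  (S : Finset (HeightOneSpectrum (𝓞 K)))
  (hpS : ∀ v : HeightOneSpectrum (𝓞 K), ((p : ℕ) : 𝓞 K) ∈ v.asIdeal → v ∈ S)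
  (hbad : ∀ v : HeightOneSpectrum (𝓞 K), v ∉ S → ((p : ℕ) : 𝓞 K) ∉ v.asIdeal → (W.baseChange K).HasGoodReductionAt v)
  (L : Set (HeightOneSpectrum (𝓞 K)))
  (hL : letI := IwasawaAlgebra.isLocalRing_quotient_X_pow_add_C p hm
    L ⊆ (W.eisensteinTower κ hm).degreeTwoPrimes p)
  (hLS : ∀ v ∈ L, v ∉ S)
  (jbar : AlgebraicClosure K →+* ℂ) (cd : ConjugationDatum K)
  (D : letI := IwasawaAlgebra.isLocalRing_quotient_X_pow_add_C p hm
    ∀ k, DualityDatum p cd ((W.eisensteinTower κ hm).ρ k) (IwasawaAlgebra.EisensteinCoeff p m (k + 1)))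
  (fs : letI := IwasawaAlgebra.isLocalRing_quotient_X_pow_add_C p hm
    ∀ (k : ℕ) (n : Finset (HeightOneSpectrum (𝓞 K))) (v : HeightOneSpectrum (𝓞 K)),
      galoisCohomology ((W.eisensteinLevelQuot κ hm k n).toLocal (Sum.inr v)) 1 →+
        SingularQuotient (GaloisRep.toLocal v (W.eisensteinLevelQuot κ hm k n)) ⊗[ℤ] Gell v)

include hm in
/-- **`SatisfiesH.h0` for the Eisenstein setting**: `T^{(k)} = E_K[p^{k+1}] ⊗ A_{m,k+1}` is a free `A_{m,k+1}`-module of rank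
two, at every level (stated on the level carrier; no setting parameter is needed).
[cite: Howard2004HeegnerKolyvagin, §1.3 H.0 (arXiv p. 7, L57) and §2.2] [cite: SilvermanAEC2009, Cor. III.6.4(b)] -/
theorem eisensteinDVRSetting_h0 (k : ℕ) :
    H0 (IwasawaAlgebra.EisensteinCoeff p m (k + 1)) (EisensteinLevel p m (fun j ↦ geomTorsion (W.baseChange K) ((p : ℤ) ^ j)) (k + 1)) := by
  have hpK : (p : K) ≠ 0 := by exact_mod_cast hp.out.ne_zero
  exact (W.baseChange K).howardH0_twisted_geomTorsion (p := p) (m := m) hpK hm (k := k + 1) k.succ_pos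

set_option synthInstance.maxHeartbeats 80000 in
/-- **The residual presentation of the setting is determined by its values on `1 ⊗ P`**: an `A_{m,k+1}`-linear map
`π : E_K[p^{k+1}] ⊗ A_{m,k+1} → E_K[p]` with `π(1 ⊗ P) = p^k P` IS `π̄_k` (pure tensors `c ⊗ P = c • (1 ⊗ P)` generate).
[cite: Howard2004HeegnerKolyvagin, proof of Prop. 2.1.3 (T̄ ≅ E[p] ⊗ S/𝔪)] -/
theorem eisensteinDVRSetting_πbar_eq_of_tmul (k : ℕ)
    (π : letI := W.residueModuleSucc (K := K) (p := p) hm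
      IwasawaAlgebra.EisensteinCoeff.Twisted p m (k + 1) (geomTorsion (W.baseChange K) ((p : ℤ) ^ (k + 1))) →ₗ[
        IwasawaAlgebra.EisensteinCoeff p m (k + 1)] geomTorsion (W.baseChange K) (p : ℤ))
    (hπ : ∀ P : geomTorsion (W.baseChange K) ((p : ℤ) ^ (k + 1)),
      ((π (IwasawaAlgebra.EisensteinCoeff.Twisted.tmul 1 P) : geomTorsion (W.baseChange K) (p : ℤ)) :
          geomPoints (W.baseChange K)) = ((p : ℤ) ^ k) • (P : geomPoints (W.baseChange K)))
    (y : IwasawaAlgebra.EisensteinCoeff.Twisted p m (k + 1) (geomTorsion (W.baseChange K) ((p : ℤ) ^ (k + 1)))) :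
    letI := IwasawaAlgebra.isDomain_quotient_X_pow_add_C p hm
    letI := IwasawaAlgebra.isDiscreteValuationRing_quotient_X_pow_add_C p hm
    haveI := IwasawaAlgebra.EisensteinCoeff.isLocalRing_succ p hm
    letI := IwasawaAlgebra.EisensteinCoeff.algebraOfSpecSucc p m
    haveI := W.isScalarTower_algebraOfSpecSucc (K := K) (p := p) (m := m)
    letI := W.residueModuleSucc (K := K) (p := p) hm
    π y = (W.eisensteinDVRSetting κ hm S hpS hbad L hL hLS jbar cd D fs).πbar k y := by
  letI := IwasawaAlgebra.isDomain_quotient_X_pow_add_C p hm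
  letI := IwasawaAlgebra.isDiscreteValuationRing_quotient_X_pow_add_C p hm
  haveI := IwasawaAlgebra.EisensteinCoeff.isLocalRing_succ p hm
  letI := IwasawaAlgebra.EisensteinCoeff.algebraOfSpecSucc p m
  haveI := W.isScalarTower_algebraOfSpecSucc (K := K) (p := p) (m := m)
  letI := W.residueModuleSucc (K := K) (p := p) hm
  induction y using IwasawaAlgebra.EisensteinCoeff.Twisted.induction_on with
  | zero => exact (map_zero π).trans (map_zero _).symm
  | add x y hx hy =>
    calc π (x + y) = π x + π y := map_add π x y
      _ = (W.eisensteinDVRSetting κ hm S hpS hbad L hL hLS jbar cd D fs).πbar k x + (W.eisensteinDVRSetting κ hm S hpS hbad L hL hLS jbar cd D fs).πbar k y := by rw [hx, hy]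
      _ = (W.eisensteinDVRSetting κ hm S hpS hbad L hL hLS jbar cd D fs).πbar k (x + y) := (map_add ((W.eisensteinDVRSetting κ hm S hpS hbad L hL hLS jbar cd D fs).πbar k) x y).symm
  | tmul c P =>
    apply Subtype.ext
    have h1 : π (IwasawaAlgebra.EisensteinCoeff.Twisted.tmul c P) =
        c • π (IwasawaAlgebra.EisensteinCoeff.Twisted.tmul 1 P) :=
      (congrArg π (IwasawaAlgebra.EisensteinCoeff.Twisted.tmul_eq_smul_tmul_one c P)).trans (map_smul π c _)
    rw [h1, IwasawaAlgebra.EisensteinCoeff.residueModule_smul p hm k.succ_pos _ c, AddSubmonoidClass.coe_nsmul, hπ P,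
      W.coe_eisensteinDVRSetting_πbar_tmul' κ hm S hpS hbad L hL hLS jbar cd D fs k c P]

set_option synthInstance.maxHeartbeats 80000 in
/-- **`SatisfiesH.h1` for the Eisenstein setting, from `(irr_K)` and the Schur form on `E_K[p]`**: Howard's H.1 (`T̄ = E_K[p]`
absolutely irreducible, presented by the PINNED `π̄_k`) at every level.
[cite: Howard2004HeegnerKolyvagin, §1.3 H.1 (arXiv p. 7, L59) and proof of Prop. 2.1.3] [cite: SilvermanAEC2009, Cor. III.6.4(b)] -/
theorem eisensteinDVRSetting_h1_of_schur (hirr : (W.baseChange K).HasIrreducibleModPGaloisRep p)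
    (hschur : ∀ φ : geomTorsion (W.baseChange K) (p : ℤ) →+ geomTorsion (W.baseChange K) (p : ℤ),
      (∀ (g : absoluteGaloisGroup K) (P : geomTorsion (W.baseChange K) (p : ℤ)), φ (g • P) = g • φ P) →
        ∃ c : ℤ, ∀ P : geomTorsion (W.baseChange K) (p : ℤ), φ P = c • P)
    (k : ℕ) :
    letI := IwasawaAlgebra.isDomain_quotient_X_pow_add_C p hm
    letI := IwasawaAlgebra.isDiscreteValuationRing_quotient_X_pow_add_C p hm
    haveI := IwasawaAlgebra.EisensteinCoeff.isLocalRing_succ p hm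
    letI := IwasawaAlgebra.EisensteinCoeff.algebraOfSpecSucc p m
    haveI := W.isScalarTower_algebraOfSpecSucc (K := K) (p := p) (m := m)
    letI := W.residueModuleSucc (K := K) (p := p) hm
    H1 (R := IwasawaAlgebra.EisensteinCoeff p m (k + 1)) ((W.eisensteinDVRSetting κ hm S hpS hbad L hL hLS jbar cd D fs).T.ρ k) (W.eisensteinDVRSetting κ hm S hpS hbad L hL hLS jbar cd D fs).ρbar ((W.eisensteinDVRSetting κ hm S hpS hbad L hL hLS jbar cd D fs).πbar k) := by
  letI := IwasawaAlgebra.isDomain_quotient_X_pow_add_C p hm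
  letI := IwasawaAlgebra.isDiscreteValuationRing_quotient_X_pow_add_C p hm
  haveI := IwasawaAlgebra.EisensteinCoeff.isLocalRing_succ p hm
  letI := IwasawaAlgebra.EisensteinCoeff.algebraOfSpecSucc p m
  haveI := W.isScalarTower_algebraOfSpecSucc (K := K) (p := p) (m := m)
  letI := W.residueModuleSucc (K := K) (p := p) hm
  have hpK : (p : K) ≠ 0 := by exact_mod_cast hp.out.ne_zero
  obtain ⟨π, hπ, hH1⟩ := (W.baseChange K).howardH1_eisensteinTwist_geomTorsion_of_schur hpK hirr hschur κ hm
    (k := k + 1) k.succ_pos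
  have hπ' : ∀ P : geomTorsion (W.baseChange K) ((p : ℤ) ^ (k + 1)),
      ((π (IwasawaAlgebra.EisensteinCoeff.Twisted.tmul 1 P) : geomTorsion (W.baseChange K) (p : ℤ)) :
          geomPoints (W.baseChange K)) = ((p : ℤ) ^ k) • (P : geomPoints (W.baseChange K)) := fun P ↦ by
    rw [hπ P, Nat.add_sub_cancel]
  have heq : π = (W.eisensteinDVRSetting κ hm S hpS hbad L hL hLS jbar cd D fs).πbar k :=
    LinearMap.ext (W.eisensteinDVRSetting_πbar_eq_of_tmul κ hm S hpS hbad L hL hLS jbar cd D fs k π hπ')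
  rw [← heq]
  exact hH1

set_option synthInstance.maxHeartbeats 80000 in
/-- **`SatisfiesH.h1` for the Eisenstein setting on the cell's frames**: under `Thm413Hypotheses` (good ordinary `p`, …) and
`(irr_K)` — the Schur clause being the tree's `exists_forall_eq_zsmul_of_hasIrreducibleModPGaloisRep`.
[cite: Howard2004HeegnerKolyvagin, §1.3 H.1 (arXiv p. 7, L59) and proof of Prop. 2.1.3] [cite: Serre1972, §1.11 Prop. 11 and Cor.] -/
theorem eisensteinDVRSetting_h1 [W.IsGloballyMinimal] {N : ℕ} {κ₀ : ZpExtension K p} {γ : absoluteGaloisGroup K}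
    (hyp : CastellaGrossiLeeSkinner2022.Thm413Hypotheses N W K p κ₀ γ)
    (hirr : (W.baseChange K).HasIrreducibleModPGaloisRep p) (k : ℕ) :
    letI := IwasawaAlgebra.isDomain_quotient_X_pow_add_C p hm
    letI := IwasawaAlgebra.isDiscreteValuationRing_quotient_X_pow_add_C p hm
    haveI := IwasawaAlgebra.EisensteinCoeff.isLocalRing_succ p hm
    letI := IwasawaAlgebra.EisensteinCoeff.algebraOfSpecSucc p m
    haveI := W.isScalarTower_algebraOfSpecSucc (K := K) (p := p) (m := m)
    letI := W.residueModuleSucc (K := K) (p := p) hm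
    H1 (R := IwasawaAlgebra.EisensteinCoeff p m (k + 1)) ((W.eisensteinDVRSetting κ hm S hpS hbad L hL hLS jbar cd D fs).T.ρ k) (W.eisensteinDVRSetting κ hm S hpS hbad L hL hLS jbar cd D fs).ρbar ((W.eisensteinDVRSetting κ hm S hpS hbad L hL hLS jbar cd D fs).πbar k) :=
  W.eisensteinDVRSetting_h1_of_schur κ hm S hpS hbad L hL hLS jbar cd D fs hirr
    (fun φ hφ ↦ hyp.exists_forall_eq_zsmul_of_hasIrreducibleModPGaloisRep hirr φ hφ) k

set_option synthInstance.maxHeartbeats 80000 in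
/-- **`SatisfiesH.h5a` for the Eisenstein setting** when the conjugation datum's `τ` is a complex conjugation of `ℚ̄`
transported to `K̄` and `p ≠ 2`: `τ` splits `E_K[p]` into one-dimensional `±`-eigenspaces, at every level.
[cite: Howard2004HeegnerKolyvagin, §1.3 H.5(a) (arXiv p. 7, L93–95) and proof of Prop. 2.1.3] [cite: GrossLMS1991, Prop. 9.5 (1)] -/
theorem eisensteinDVRSetting_h5a {c₀ : absoluteGaloisGroup ℚ} (hc₀ : IsComplexConjugation (Rat.castHom ℝ) c₀)
    (hτ : ∀ x, cd.τ x = absGaloisTransport (K := ℚ) (L := K) c₀ x) (hp2 : p ≠ 2) (k : ℕ) :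
    letI := IwasawaAlgebra.isDomain_quotient_X_pow_add_C p hm
    letI := IwasawaAlgebra.isDiscreteValuationRing_quotient_X_pow_add_C p hm
    haveI := IwasawaAlgebra.EisensteinCoeff.isLocalRing_succ p hm
    letI := IwasawaAlgebra.EisensteinCoeff.algebraOfSpecSucc p m
    haveI := W.isScalarTower_algebraOfSpecSucc (K := K) (p := p) (m := m)
    letI := W.residueModuleSucc (K := K) (p := p) hm
    H5a (R := IwasawaAlgebra.EisensteinCoeff p m (k + 1)) ((W.eisensteinDVRSetting κ hm S hpS hbad L hL hLS jbar cd D fs).A k) :=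
  W.h5a_residualTauGeomTorsion_of_isComplexConjugation (p := p) cd hc₀ hτ hm (k := k + 1) k.succ_pos hp2

end WeierstrassCurve

end
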